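import Summits.PneNP.PneNP.Theorems.OracleRefusal.Negative.ParityPrograms

/-!
# `OracleRefusal` (stmt-PneNP-14658, route PneNP/LightLogic) — negative side: keyed rows of the parity programs

Refuter crux-attack (generation 2, 2026-08-16), file 1 of 2 (file 2: `OracleRefusalFalseOfWordInversion.lean`, the negative
lemma `ParityTable.WordInversion → ¬ OracleRefusal`). The witness clique against the typed crux
`Summit.PneNP.PneNP.Theses.LightLogic.OracleRefusal` at `n = 0`, `m = 1`, built INSIDE the interpretations of the two
parity programs `λs. s STEP b` of `ParityPrograms.lean` (so that the finiteness hypothesis of the crux is free):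

* §1 the `NOT`-tower `tw s r j` over an answer `r` of class `s` (classes alternate: `cls`), the letter points `lp`, the
  `STEP`-edges `edge`, the iterator boxes `box = d·gen + e·[![]]` (dilation `d`, padding `e`), KEYS
  `key = (!box)‾ ⅋ (![tw |w|]‾ ⅋ r)` and ROWS `row = ![key]‾ ⅋ r`;
* §2 the `t`-action (`t ≥ 1`) maps rows to rows (`act_row`: the answer is acted upon, multiplicities possibly dilated);
* §3 rows are points of `⟦λs. s STEP 0⟧ ∪ ⟦λs. s STEP 1⟧` (`row_mem_union`, from `Parity.prog_row_mem`, `Parity.step_tower_*`);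
* §4 the clique `cO O` of all rows of all words over answers of the class dictated by `χ_O`: a sub-clique of
  `⟦Π₀⟧ ∪ ⟦Π₁⟧` (`cO_subset_union`), hence FINITARY for the finiteness structure generated by syntax — the hypothesis of
  the crux verbatim (`synFinitary_cO`) — and obsessional from threshold `1` (`obsessionalFrom_cO`), for EVERY language `O`.

Nothing here asserts a Theses statement. All names live in the sub-namespace `ParityTable`.
-/

namespace Summit.PneNP.PneNP.Theorems.OracleRefusal.Negative

open Literature.Computability.ImplicitComplexity
open Literature.Computability.ImplicitComplexity.STA
open Literature.Computability.ImplicitComplexity.URel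

namespace ParityTable

/-! ## §1 Letters, the `NOT`-tower, edges, keys, rows -/

/-- The class-`o` answer clique: `false ↦ ⟦0⟧` (GMR08's accepting `0`), `true ↦ ⟦1⟧`. [folklore] -/
def cl : Bool → Set Point
  | false => zeroClique
  | true => oneClique

/-- The Boolean point of class `o` over the axiom label `a`: `0•a = ![a]‾ ⅋ (![]‾ ⅋ a)`, `1•a = ![]‾ ⅋ (![a]‾ ⅋ a)`.
[cite: LaurentTortoraDeFalco2006, Def. 12] -/
noncomputable def bpt : Bool → Point → Point
  | false, a => zeroPoint a
  | true, a => onePoint a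

/-- `bpt o a ∈ cl o`. [folklore] -/
theorem bpt_mem (o : Bool) (a : Point) : bpt o a ∈ cl o := by
  cases o
  · exact ⟨a, rfl⟩
  · exact ⟨a, rfl⟩

/-- The two answer cliques separate the classes. [folklore] -/
theorem eq_of_mem_cl {o o' : Bool} {x : Point} (h : x ∈ cl o) (h' : x ∈ cl o') : o = o' := by
  cases o <;> cases o'
  · rfl
  · exact absurd (Set.disjoint_left.1 disjoint_zeroClique_oneClique h) (fun hn => hn h')
  · exact absurd (Set.disjoint_left.1 disjoint_zeroClique_oneClique h') (fun hn => hn h)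
  · rfl

/-- `bpt o a` lies in `cl o'` only for `o' = o`. [folklore] -/
theorem eq_of_bpt_mem {o o' : Bool} {a : Point} (h : bpt o a ∈ cl o') : o = o' :=
  eq_of_mem_cl (bpt_mem o a) h

/-- The answer cliques are closed under every action of threshold `≥ 1`. [cite: LaurentTortoraDeFalco2006, Def. 13] -/
theorem act_mem_cl {t : ℕ} (ht : 1 ≤ t) (k : ℕ) {o : Bool} {x : Point} (hx : x ∈ cl o) : Point.act t k x ∈ cl o := by
  cases o
  · obtain ⟨a, rfl⟩ := hx
    exact ⟨a.act t k, (act_zeroPoint ht k a).symm⟩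
  · obtain ⟨a, rfl⟩ := hx
    exact ⟨a.act t k, (act_onePoint ht k a).symm⟩

/-- `(bpt o a)ₜ⁽ᵏ⁾ = bpt o (a)ₜ⁽ᵏ⁾` (`t ≥ 1`). [cite: LaurentTortoraDeFalco2006, Def. 13] -/
theorem act_bpt {t : ℕ} (ht : 1 ≤ t) (k : ℕ) (o : Bool) (a : Point) :
    Point.act t k (bpt o a) = bpt o (a.act t k) := by
  cases o
  · exact act_zeroPoint ht k a
  · exact act_onePoint ht k a

/-- The class of the `j`-th accumulator of the tower over an answer of class `s`: it alternates. [folklore] -/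
def cls (s : Bool) : ℕ → Bool
  | 0 => s
  | j + 1 => !(cls s j)

/-- `NOT` on points: an accumulator of class `o` over `a` is wrapped into the Boolean point of the other class
(`⟦y 1 0⟧` peels one layer: `ParityPrograms.step_tower_*`). [folklore] -/
noncomputable def wrap (o : Bool) (a : Point) : Point := bpt (!o) a

/-- The `NOT`-tower over the final answer `r` (class `s`): `tw 0 = r`, `tw (j+1) = wrap (cls j) (tw j)`; `tw j` is the
value threaded out of the `j`-th head of the word. [folklore] -/
noncomputable def tw (s : Bool) (r : Point) : ℕ → Point
  | 0 => r
  | j + 1 => wrap (cls s j) (tw s r j)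

/-- Every level of the tower lies in the clique of its class. [folklore] -/
theorem tw_mem {s : Bool} {r : Point} (hr : r ∈ cl s) : ∀ j, tw s r j ∈ cl (cls s j)
  | 0 => hr
  | j + 1 => by
      show bpt (!cls s j) (tw s r j) ∈ cl (!cls s j)
      exact bpt_mem _ _

/-- The dereliction point `![x]‾ ⅋ x` (the only run of `I = λu.u`). [cite: LaurentTortoraDeFalco2006, §2.2] -/
noncomputable def derel (x : Point) : Point := (bang1 x).dual.par x

/-- The letter point read by the `j`-th head: the letter `b` (`0 = λxy.x` / `1 = λxy.y`) applied to `I` (used once, at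
`derel a`) and `I` (discarded), value `a`. [cite: LaurentTortoraDeFalco2006, Def. 12] -/
noncomputable def lp (b : Bool) (a : Point) : Point := bpt b (derel a)

/-- The run point of `STEP` at a head reading letter `b` with value `a` and accumulator `a'`:
`![lp b a]‾ ⅋ (![a']‾ ⅋ a)`. [cite: LaurentTortoraDeFalco2006, Def. 12] -/
noncomputable def edge (b : Bool) (a a' : Point) : Point := (bang1 (lp b a)).dual.par ((bang1 a').dual.par a)

/-- The genuine elements of the iterator box of a key of `w` (class `s`, answer `r`): one `STEP`-run per letter.
[cite: LaurentTortoraDeFalco2006, Def. 12] -/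
noncomputable def gen (w : List Bool) (s : Bool) (r : Point) : Multiset Point :=
  (Multiset.range w.length).map fun j => bang1 (edge (w.getD j false) (tw s r j) (tw s r (j + 1)))

/-- The iterator box of a key: `d` copies of every genuine element and `e` empty boxes `![]` (dilations and
phantom/dummy copies). [cite: LaurentTortoraDeFalco2006, Def. 12–13] -/
noncomputable def box (w : List Bool) (s : Bool) (r : Point) (d e : ℕ) : Multiset Point :=
  d • gen w s r + e • ({bang0} : Multiset Point)

/-- **The key** of the word `w` with answer `r` of class `s`: `(!box)‾ ⅋ (![tw |w|]‾ ⅋ r)` — the point at which a parity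
program consumes (one copy of) the word. [cite: LaurentTortoraDeFalco2006, Def. 12] -/
noncomputable def key (w : List Bool) (s : Bool) (r : Point) (d e : ℕ) : Point :=
  (Point.ofCourse (box w s r d e)).dual.par ((bang1 (tw s r w.length)).dual.par r)

/-- **The row** `![key]‾ ⅋ r`: a point of a program of type `S₁ ⊸ B` answering `r` on the key. [cite: LaurentTortoraDeFalco2006, Def. 12] -/
noncomputable def row (w : List Bool) (s : Bool) (r : Point) (d e : ℕ) : Point :=
  (bang1 (key w s r d e)).dual.par r

/-! ## §2 The action on towers, keys and rows -/

section Act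

variable {t : ℕ} (ht : 1 ≤ t) (k : ℕ)
include ht

/-- `(derel x)ₜ⁽ᵏ⁾ = derel (x)ₜ⁽ᵏ⁾`. [cite: LaurentTortoraDeFalco2006, Def. 13] -/
theorem act_derel (x : Point) : Point.act t k (derel x) = derel (x.act t k) := by
  simp [derel, Point.act_par, ← Point.dual_act, act_bang1 ht]

/-- `(wrap o a)ₜ⁽ᵏ⁾ = wrap o (a)ₜ⁽ᵏ⁾`. [cite: LaurentTortoraDeFalco2006, Def. 13] -/
theorem act_wrap (o : Bool) (a : Point) : Point.act t k (wrap o a) = wrap o (a.act t k) :=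
  act_bpt ht k (!o) a

/-- The action commutes with the tower. [cite: LaurentTortoraDeFalco2006, Def. 13] -/
theorem act_tw (s : Bool) (r : Point) : ∀ j, Point.act t k (tw s r j) = tw s (r.act t k) j
  | 0 => rfl
  | j + 1 => by
      show Point.act t k (wrap (cls s j) (tw s r j)) = wrap (cls s j) (tw s (r.act t k) j)
      rw [act_wrap ht, act_tw s r j]

/-- `(lp b a)ₜ⁽ᵏ⁾ = lp b (a)ₜ⁽ᵏ⁾`. [cite: LaurentTortoraDeFalco2006, Def. 13] -/
theorem act_lp (b : Bool) (a : Point) : Point.act t k (lp b a) = lp b (a.act t k) := by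
  simp [lp, act_bpt ht, act_derel ht]

/-- `(edge b a a')ₜ⁽ᵏ⁾ = edge b (a)ₜ⁽ᵏ⁾ (a')ₜ⁽ᵏ⁾`. [cite: LaurentTortoraDeFalco2006, Def. 13] -/
theorem act_edge (b : Bool) (a a' : Point) :
    Point.act t k (edge b a a') = edge b (a.act t k) (a'.act t k) := by
  simp [edge, Point.act_par, ← Point.dual_act, act_bang1 ht, act_lp ht]

/-- The genuine elements are mapped to the genuine elements of the acted-upon answer. [cite: LaurentTortoraDeFalco2006, Def. 13] -/
theorem gen_map_act (w : List Bool) (s : Bool) (r : Point) :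
    (gen w s r).map (Point.act t k) = gen w s (r.act t k) := by
  simp only [gen, Multiset.map_map, Function.comp_def]
  refine Multiset.map_congr rfl fun j _ => ?_
  rw [act_bang1 ht, act_edge ht, act_tw ht, act_tw ht]

/-- The box is mapped to a box (same or dilated multiplicities). [cite: LaurentTortoraDeFalco2006, Def. 13] -/
theorem act_ofCourse_box {k : ℕ} (hk : 0 < k) (w : List Bool) (s : Bool) (r : Point) (d e : ℕ) :
    ∃ d' e', (1 ≤ d → 1 ≤ d') ∧
      Point.act t k (Point.ofCourse (box w s r d e)) = Point.ofCourse (box w s (r.act t k) d' e') := by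
  rw [Point.act_ofCourse]
  have hmap : (box w s r d e).map (Point.act t k) = box w s (r.act t k) d e := by
    simp only [box, Multiset.map_add, Multiset.map_nsmul, gen_map_act ht, Multiset.map_singleton, act_bang0]
  rw [hmap]
  unfold mbump
  split_ifs
  · exact ⟨d, e, fun hd => hd, rfl⟩
  · refine ⟨k * d, k * e, fun hd => one_le_mul (Nat.one_le_of_lt hk) hd, ?_⟩
    simp only [box, smul_add, ← mul_smul]

/-- **Rows go to rows** under every action of threshold `≥ 1` (the answer is acted upon, multiplicities possibly
dilated). [cite: LaurentTortoraDeFalco2006, Def. 13] -/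
theorem act_row {k : ℕ} (hk : 0 < k) (w : List Bool) (s : Bool) (r : Point) (d e : ℕ) :
    ∃ d' e', (1 ≤ d → 1 ≤ d') ∧ Point.act t k (row w s r d e) = row w s (r.act t k) d' e' := by
  obtain ⟨d', e', hd, hbox⟩ := act_ofCourse_box ht hk w s r d e
  refine ⟨d', e', hd, ?_⟩
  simp only [row, key, Point.act_par, ← Point.dual_act, act_bang1 ht, hbox, act_tw ht]

end Act

/-! ## §3 Rows are points of the parity programs -/

open Parity

/-- The `j`-th edge of the tower is a run of `STEP` ("`NOT` peels one layer", `Parity.step_tower_*`).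
[cite: LaurentTortoraDeFalco2006, Def. 12] -/
theorem edge_mem_STEP {s : Bool} {r : Point} (hr : r ∈ cl s) (b : Bool) (j : ℕ) :
    edge b (tw s r j) (tw s r (j + 1)) ∈ SoftProgramInterpretation STEPD := by
  have hj := tw_mem hr j
  show edge b (tw s r j) (wrap (cls s j) (tw s r j)) ∈ _
  generalize tw s r j = a at hj ⊢
  generalize cls s j = o at hj ⊢
  cases o <;> cases b
  · simpa [edge, lp, bpt, wrap, derel] using (step_tower_ff a).1 hj
  · simpa [edge, lp, bpt, wrap, derel] using (step_tower_tt a).1 hj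
  · simpa [edge, lp, bpt, wrap, derel] using (step_tower_ff a).2 hj
  · simpa [edge, lp, bpt, wrap, derel] using (step_tower_tt a).2 hj

/-- The elements of a box are empty boxes or one-copy boxes of `STEP`-runs. [cite: LaurentTortoraDeFalco2006, Def. 12] -/
theorem box_elements {s : Bool} {r : Point} (hr : r ∈ cl s) (w : List Bool) (d e : ℕ) :
    ∀ x ∈ box w s r d e, x = bang0 ∨ ∃ y ∈ SoftProgramInterpretation STEPD, x = bang1 y := by
  intro x hx
  rcases Multiset.mem_add.1 hx with hx | hx
  · obtain ⟨j, -, rfl⟩ := Multiset.mem_map.1 (Multiset.mem_of_mem_nsmul hx)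
    exact Or.inr ⟨_, edge_mem_STEP hr _ j, rfl⟩
  · exact Or.inl (Multiset.mem_singleton.1 (Multiset.mem_of_mem_nsmul hx))

/-- **Rows are program points**: a row over an answer of class `s` lies in `⟦λs. s STEP 0⟧` or `⟦λs. s STEP 1⟧`
(according to the class of the top of its tower). [cite: LaurentTortoraDeFalco2006, Def. 12] -/
theorem row_mem_union {s : Bool} {r : Point} (hr : r ∈ cl s) (w : List Bool) (d e : ℕ) :
    row w s r d e ∈ SoftProgramInterpretation (progD zD) ∪ SoftProgramInterpretation (progD oD) := by
  have hM := box_elements hr w d e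
  have hk := tw_mem hr w.length
  cases hcls : cls s w.length
  · rw [hcls] at hk
    have hB : (noneVal, bang1 (tw s r w.length)) ∈ liftArg 0 Ctx.empty zD.interp :=
      lift_bang1 zD (by rw [zD, softProgramInterpretation_zeroD]; exact hk)
    exact Or.inl (prog_row_mem zD hM hB r)
  · rw [hcls] at hk
    have hB : (noneVal, bang1 (tw s r w.length)) ∈ liftArg 0 Ctx.empty oD.interp :=
      lift_bang1 oD (by rw [oD, softProgramInterpretation_oneD]; exact hk)
    exact Or.inr (prog_row_mem oD hM hB r)

/-! ## §4 The clique `cO`: a finitary, obsessional sub-clique of `⟦Π₀⟧ ∪ ⟦Π₁⟧` for every language -/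

/-- The class of the answer on `w`: `false` (accept, `⟦0⟧`) iff `w ∈ O`. [folklore] -/
noncomputable def sgn (O : Language Bool) (w : List Bool) : Bool := by
  classical exact decide (w ∉ O)

/-- On words of `O` the answer clique is `⟦0⟧`. [folklore] -/
theorem cl_sgn_of_mem {O : Language Bool} {w : List Bool} (h : w ∈ O) : cl (sgn O w) = zeroClique := by
  have : sgn O w = false := by simp [sgn, h]
  rw [this]; rfl

/-- Off `O` the answer clique is `⟦1⟧`. [folklore] -/
theorem cl_sgn_of_not_mem {O : Language Bool} {w : List Bool} (h : w ∉ O) : cl (sgn O w) = oneClique := by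
  have : sgn O w = true := by simp [sgn, h]
  rw [this]; rfl

/-- **The deciding clique of `O`**: all rows of all words over answers of the right class, all dilations `d ≥ 1`,
all paddings `e`. [folklore] -/
def cO (O : Language Bool) : Set Point :=
  {x | ∃ (w : List Bool) (r : Point) (d e : ℕ), 1 ≤ d ∧ r ∈ cl (sgn O w) ∧ x = row w (sgn O w) r d e}

/-- `cO O ⊆ ⟦Π₀⟧ ∪ ⟦Π₁⟧`. [folklore] -/
theorem cO_subset_union (O : Language Bool) :
    cO O ⊆ SoftProgramInterpretation (progD zD) ∪ SoftProgramInterpretation (progD oD) := by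
  rintro _ ⟨w, r, d, e, -, hr, rfl⟩
  exact row_mem_union hr w d e

/-- **`cO O` is finitary** for the finiteness structure generated by syntax at `!⁰S₁ ⊸ B` (the hypothesis of the crux
`OracleRefusal`, verbatim, at `n = 0`, `m = 1`). [folklore] -/
theorem synFinitary_cO (O : Language Bool) :
    ∀ u : Set Point, (∀ (d : ℕ) (M : Term) (D : Deriv d Ctx.empty M (progTy 0 1)),
      M.SumFree → (u ∩ SoftProgramInterpretation D).Finite) → (u ∩ cO O).Finite :=
  synFinitary_of_subset_union (progD zD) (progD oD) sumFree_prog_zero sumFree_prog_one (cO_subset_union O)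

/-- **`cO O` is obsessional from threshold `1`.** [cite: LaurentTortoraDeFalco2006, Def. 13] -/
theorem obsessionalFrom_cO (O : Language Bool) : ObsessionalFrom 1 (cO O) := by
  intro t ht x hx k hk
  obtain ⟨w, r, d, e, hd, hr, rfl⟩ := hx
  obtain ⟨d', e', hd', h⟩ := act_row ht hk w (sgn O w) r d e
  rw [h]
  exact ⟨w, r.act t k, d', e', hd' hd, act_mem_cl ht k hr, rfl⟩


end ParityTable

end Summit.PneNP.PneNP.Theorems.OracleRefusal.Negative
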